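import Literature.NumberTheory.Automorphic.CDTTheorem722
import Literature.NumberTheory.Automorphic.CDTTheorem722Proofs
import Literature.NumberTheory.Automorphic.CDTTheorem722ThreeFactsProofs
import Literature.NumberTheory.EllipticCurves.CuspFormLFunctionLevelConductorOfCarayolProofs
import Literature.NumberTheory.EllipticCurves.EichlerShimuraCongruenceHondaProofs
import Literature.NumberTheory.EllipticCurves.EichlerShimuraConstructionCongruenceProofs
import Literature.NumberTheory.EllipticCurves.EichlerShimuraConstructionReductionProofs
import Literature.NumberTheory.EllipticCurves.IsogenyFaltingsLFunctionProofs
import Literature.NumberTheory.EllipticCurves.IsogenyFrobeniusTraceHoldsProofs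
import Literature.NumberTheory.EllipticCurves.ShafarevichGoodReductionBadPlacesProofs
import Literature.NumberTheory.EllipticCurves.NewformGaloisRepEulerFactors
import Literature.NumberTheory.EllipticCurves.CuspFormLFunctionLevelConductorProofs
import HarnessLib

/-!
# STUB-IDEAS companion · `stub_threeImpTwo` (S9) · ideator k1 · gen 4 · FAMILY 1 (recognise & import)

Crux `FreyModularity` (stmt-ABC-11340, route-ABC-DefiniteXi); registered skeleton
`Cruxes/FreyModularity/Lines/Sketch.lean` (sha 21576c53).  Elaboration sanity only: the statements
below are the helper lemmas of `STUB-IDEAS-stub_threeImpTwo-1.md` (gen 4).  PROVED here (no sorry):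
the two cheap sockets S1/S2, the Honda–Faltings isogeny lemma H1 and the one-prime transfer H2.
SORRIED (one prover cycle each, recipes in the card): H3, H4, H4′, H5 — they re-glue gen-3's
0-sorry companion `STUB_IDEAS_stub_threeImpTwo_1_Sketch.lean` (B1 `ratGaloisRepCofinalAt_of_curve`,
B2 `isNewformOf_of_cofinalAt_of_carayolEuler`, B3 `isNewformOf_of_carayolEuler_of_dvd_level`), which
is a crux workfile and cannot be imported here.

NEW TREE MATCHES USED (none of the nine earlier cards cites them):
* `congruenceRelation_cofinite_of_int` (`EichlerShimuraCongruenceHondaProofs`, Honda 1970 §6.2 Thm. 9):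
  the Eichler–Shimura congruence `a_p(f) = a_p(E_f)` for `E_f = ℂ/Λ_f`, COFINITELY in `p`,
  UNCONDITIONALLY;
* `isIsogenous_of_finite_setOf_LFunction_ne` + `isIsogenous_iff_frobeniusTrace_eq_holds` (Faltings,
  a.e. form, landed);
* `IsIsogenous.hasGoodReductionAt_iff_of_isIsogenous`, `IsIsogenous.LFunction_eq`,
  `IsNewformOf.of_isIsogenous` (isogeny invariance, landed);
* `eichlerShimuraConstruction_of_exists_isNewformOf` (the skeleton's `hES` binder is, as of today,
  literally "modularity of the curves `ℂ/Λ_f`" — circular for this crux unless fed by H5).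
-/

noncomputable section

open scoped NumberField Polynomial MatrixGroups ModularForm
open NumberField IsDedekindDomain IsDedekindDomain.HeightOneSpectrum Field
open CongruenceSubgroup Rat.HeightOneSpectrum
open Literature.NumberTheory.EllipticCurves
open Literature.NumberTheory.EllipticCurves.ModularForms
open Literature.NumberTheory.Automorphic
open Literature.NumberTheory.Automorphic.BCDT
open Literature.NumberTheory.GaloisRepresentations
open WeierstrassCurve

namespace Summit.ABC.ABC.Cruxes.FreyModularity.Sketch.StubIdeasThreeImpTwo1G4

/-- The stub, verbatim. -/
def SigStubThreeImpTwo : Prop :=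
  ∀ (W : WeierstrassCurve ℚ) [W.IsElliptic] [NeZero (W.conductorNorm ℤ)] (ℓ : ℕ) [Fact ℓ.Prime],
    W.IsModularGaloisRepTate ℓ → BCDT.IsModular W

/-- The `ℚ`-model `E_f : y² = x³ + a₄ x + a₆` of `ℂ/Λ_f` (same literal as the tree's statements). -/
abbrev shortModel (a₄ a₆ : ℚ) : WeierstrassCurve ℚ :=
  { a₁ := 0, a₂ := 0, a₃ := 0, a₄ := a₄, a₆ := a₆ }

/-- The finite place of `ℚ` at the rational prime `ℓ`. -/
abbrev placeOf (ℓ : ℕ) [Fact ℓ.Prime] : HeightOneSpectrum (𝓞 ℚ) :=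
  primesEquiv.symm ⟨ℓ, Fact.out⟩

theorem primesEquiv_placeOf (ℓ : ℕ) [Fact ℓ.Prime] : (primesEquiv (placeOf ℓ) : ℕ) = ℓ := by
  rw [placeOf, Equiv.apply_symm_apply]

/-! ### D1 · the ONE-PRIME leaf: Eichler–Shimura congruence and Igusa AT `ℓ` only -/

/-- **D1 `CongruenceAt ℓ`** (hypothesis shape; binders verbatim those of the catalogued
`eichlerShimuraCongruenceRelation` and of gen-3's `IgusaGoodReduction`).  For every RATIONAL newform
`f ∈ S₂(Γ₀(N))` with `ℓ ∤ N` and the `ℚ`-model `E_f` of `ℂ/Λ_f`: `E_f` has good reduction at `ℓ`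
AND `a_ℓ(f) = a_ℓ(E_f)`.  (Knapp Thm. 11.74 (d)(e) PDF p. 287 + Notes p. 312 (Igusa 1959); Shimura
1971 Thm. 7.14/7.15 — AT ONE PRIME.)  By `congruenceRelation_cofinite_of_int` it can only fail at the
finitely many Honda-exceptional primes of `f`. -/
def CongruenceAt (ℓ : ℕ) [Fact ℓ.Prime] : Prop :=
  ∀ (N : ℕ) [NeZero N] (f : CuspForm (Gamma0 N) 2), IsNewform0 f → coeffField f = ⊥ →
    ∀ (L : PeriodPair), L.lattice.toAddSubgroup = periodLattice f →
      ∀ a₄ a₆ : ℚ, L.g₂ = -4 * (a₄ : ℂ) → L.g₃ = -4 * (a₆ : ℂ) → ¬ ℓ ∣ N →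
        (shortModel a₄ a₆).HasGoodReductionAt (placeOf ℓ) ∧
        (UpperHalfPlane.qExpansion 1 ⇑f).coeff ℓ = ((shortModel a₄ a₆).LFunction ℓ : ℂ)

/-- The catalogued child `Literature.NumberTheory.EllipticCurves.ModularForms.eichlerShimuraCongruenceRelation`
(`EichlerShimuraCongruenceRelation.lean:105`), restated VERBATIM because that module is not yet built
on the check farm (stale:unbuilt, 2026-08-31); same name and text as gen-3's restatement, so the
two Props are syntactically identical. -/
def EichlerShimuraCongruenceRelation : Prop :=
  ∀ (N : ℕ) [NeZero N] (f : CuspForm (Gamma0 N) 2), IsNewform0 f → coeffField f = ⊥ →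
    ∀ (L : PeriodPair), L.lattice.toAddSubgroup = periodLattice f →
      ∀ a₄ a₆ : ℚ, L.g₂ = -4 * (a₄ : ℂ) → L.g₃ = -4 * (a₆ : ℂ) →
        ∀ p : ℕ, p.Prime → ¬ p ∣ N →
          (UpperHalfPlane.qExpansion 1 ⇑f).coeff p =
            (({ a₁ := 0, a₂ := 0, a₃ := 0, a₄ := a₄, a₆ := a₆ } : WeierstrassCurve ℚ).LFunction
              p : ℂ)

/-- Gen-3's Igusa leaf, verbatim (for socket S1). -/
def IgusaGoodReduction : Prop :=
  ∀ (N : ℕ) [NeZero N] (f : CuspForm (Gamma0 N) 2), IsNewform0 f → coeffField f = ⊥ →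
    ∀ (L : PeriodPair), L.lattice.toAddSubgroup = periodLattice f →
      ∀ a₄ a₆ : ℚ, L.g₂ = -4 * (a₄ : ℂ) → L.g₃ = -4 * (a₆ : ℂ) →
        ∀ v : HeightOneSpectrum (𝓞 ℚ), ¬ ((primesEquiv v : ℕ) ∣ N) →
          ({ a₁ := 0, a₂ := 0, a₃ := 0, a₄ := a₄, a₆ := a₆ } : WeierstrassCurve ℚ).HasGoodReductionAt v

/-- **S1** catalogued child `eichlerShimuraCongruenceRelation` (restated) + Igusa ⇒ `CongruenceAt ℓ` for every
`ℓ` (specialisation). PROVED. -/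
theorem congruenceAt_of_congruenceRelation_of_igusa (hCR : EichlerShimuraCongruenceRelation)
    (hIg : IgusaGoodReduction) (ℓ : ℕ) [Fact ℓ.Prime] : CongruenceAt ℓ := by
  intro N _ f hf hQ L hL a₄ a₆ h₂ h₃ hℓN
  refine ⟨hIg N f hf hQ L hL a₄ a₆ h₂ h₃ _ (by rw [primesEquiv_placeOf]; exact hℓN), ?_⟩
  exact hCR N f hf hQ L hL a₄ a₆ h₂ h₃ ℓ Fact.out hℓN

/-- **S2** the skeleton's `hES` (`eichlerShimuraConstruction`) ⇒ `CongruenceAt ℓ` for every `ℓ`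
(`isNewformOf_shortModel_of_eichlerShimuraConstruction`: `aₙ(E_f) = aₙ(f)` for all `n`, and
`p ∣ N ↔ p ∣ N_{E_f}`). PROVED. -/
theorem congruenceAt_of_eichlerShimuraConstruction (hES : eichlerShimuraConstruction)
    (ℓ : ℕ) [Fact ℓ.Prime] : CongruenceAt ℓ := by
  intro N _ f hf hQ L hL a₄ a₆ h₂ h₃ hℓN
  haveI := isElliptic_shortModel h₂ h₃
  have hWf := isNewformOf_shortModel_of_eichlerShimuraConstruction hES hf hQ hL h₂ h₃
  refine ⟨?_, ?_⟩
  · by_contra hbad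
    have hd := ((shortModel a₄ a₆).dvd_conductorNorm_iff (placeOf ℓ)).mpr hbad
    rw [primesEquiv_placeOf] at hd
    exact hℓN ((hWf.dvd_level_iff_dvd_conductorNorm (Fact.out : ℓ.Prime)).mpr hd)
  · have h := hWf.2 ℓ
    rw [cuspCoeff] at h
    exact h

/-! ### H1 · Honda + Faltings: a curve sharing `a_p` with a rational newform off a finite set is
`ℚ`-isogenous to `E_f` -/

/-- **H1 (isogeny lemma; NEW, from landed theorems only).**  `W/ℚ` elliptic, `f ∈ S₂(Γ₀(N))` a
newform with integer coefficients, `a_p(f) = a_p(W)` for all primes outside a finite set `S` ⇒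
`W ~_ℚ E_f`: the two curves have equal `a_p` off `S ∪ (Honda-exceptional set of f)`
(`congruenceRelation_cofinite_of_int`), so Faltings (`isIsogenous_of_finite_setOf_LFunction_ne`,
`isIsogenous_iff_frobeniusTrace_eq_holds`) applies.  In particular every `W` with
`ρ_{W,ℓ}` modular is isogenous to the `ℂ/Λ_f` of its (descended, rational) newform. PROVED. -/
theorem isIsogenous_shortModel_of_cuspCoeff_eq_off (W : WeierstrassCurve ℚ) [W.IsElliptic]
    {N : ℕ} [NeZero N] (f : CuspForm (Gamma0 N) 2) (hf : IsNewform0 f)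
    (hint : ∀ n, ∃ m : ℤ, (m : ℂ) = cuspCoeff f n) (L : PeriodPair)
    (hL : L.lattice.toAddSubgroup = periodLattice f) (a₄ a₆ : ℚ) (h₂ : L.g₂ = -4 * (a₄ : ℂ))
    (h₃ : L.g₃ = -4 * (a₆ : ℂ)) {S : Set ℕ} (hS : S.Finite)
    (hap : ∀ p : ℕ, p.Prime → p ∉ S → cuspCoeff f p = (W.LFunction p : ℂ)) :
    IsIsogenous W (shortModel a₄ a₆) := by
  haveI := isElliptic_shortModel h₂ h₃
  refine isIsogenous_of_finite_setOf_LFunction_ne isIsogenous_iff_frobeniusTrace_eq_holds W _ ?_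
  refine (hS.union (congruenceRelation_cofinite_of_int f hf hint L hL a₄ a₆ h₂ h₃)).subset ?_
  rintro p ⟨hp, hne⟩
  by_contra hmem
  simp only [Set.mem_union, Set.mem_setOf_eq, not_or, not_and, not_not] at hmem
  apply hne
  have h1 : cuspCoeff f p = (W.LFunction p : ℂ) := hap p hp hmem.1
  have h2 : cuspCoeff f p = ((shortModel a₄ a₆).LFunction p : ℂ) := hmem.2 hp
  exact_mod_cast h1.symm.trans h2

/-- **H2 (one-prime transfer; NEW).**  Under `CongruenceAt ℓ`: for descended data (`f` rational
newform of level `N`, `ℓ ∤ N`, `a_p(f) = a_p(W)` off a finite set) the curve `W` has good reduction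
at `ℓ` and `a_ℓ(f) = a_ℓ(W)` — by H1 and isogeny invariance
(`IsIsogenous.hasGoodReductionAt_iff_of_isIsogenous`, `IsIsogenous.LFunction_eq`).  This is gen-3's
`HoleFiller` + G3.B5's `a_ℓ` step with the child consumed at `p = ℓ` ONLY and Igusa at `v = ℓ`
ONLY (gen 3 needed the child at every `p ∤ N` to build its Brauer–Nesbitt transfer). PROVED. -/
theorem hasGoodReductionAt_and_cuspCoeff_eq_of_congruenceAt (ℓ : ℕ) [Fact ℓ.Prime]
    (hCA : CongruenceAt ℓ) (W : WeierstrassCurve ℚ) [W.IsElliptic] {N : ℕ} [NeZero N]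
    (f : CuspForm (Gamma0 N) 2) (hf : IsNewform0 f) (hrat : ∀ n : ℕ, ∃ z : ℤ, cuspCoeff f n = z)
    {S : Set ℕ} (hS : S.Finite)
    (hap : ∀ p : ℕ, p.Prime → p ∉ S → cuspCoeff f p = (W.LFunction p : ℂ)) (hℓN : ¬ ℓ ∣ N) :
    W.HasGoodReductionAt (placeOf ℓ) ∧ cuspCoeff f ℓ = (W.LFunction ℓ : ℂ) := by
  have hint : ∀ n, ∃ m : ℤ, (m : ℂ) = cuspCoeff f n := fun n ↦ (hrat n).imp fun m hm ↦ hm.symm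
  have hQ : coeffField f = ⊥ := coeffField_eq_bot_of_forall_exists_intCast hrat
  obtain ⟨Lf, hLf⟩ := hf.exists_periodPair_of_coeffField_eq_bot hQ
  obtain ⟨a₄, a₆, h₂, h₃⟩ := hf.exists_rat_g₂_g₃_of_lattice_eq_periodLattice hQ Lf hLf
  haveI := isElliptic_shortModel h₂ h₃
  have hiso := isIsogenous_shortModel_of_cuspCoeff_eq_off W f hf hint Lf hLf a₄ a₆ h₂ h₃ hS hap
  obtain ⟨hgood, haℓ⟩ := hCA N f hf hQ Lf hLf a₄ a₆ h₂ h₃ hℓN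
  refine ⟨(hiso.hasGoodReductionAt_iff_of_isIsogenous (placeOf ℓ)).mpr hgood, ?_⟩
  rw [cuspCoeff, haℓ, hiso.LFunction_eq]

/-! ### H3–H4 · the closers (sorried: they re-glue gen-3's B1/B2/B3, one prover cycle each) -/

/-- **H3 (per-newform closer).**  = gen-3 G3.B5 with its inputs `hCR` (child at EVERY `p ∤ N`) and
`hℓ : W good at ℓ` REPLACED by `CongruenceAt ℓ`.  Recipe: `by_cases ℓ ∣ N` → gen-3 B3
`isNewformOf_of_carayolEuler_of_dvd_level hCE …` verbatim (ES-free); else H2 with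
`S := {p | p ∣ N * ℓ}` gives `W` good at `ℓ` and `a_ℓ`, hence `W` good off `N` and `a_p(f₀) = a_p(W)`
for all `p ∤ N`, then gen-3 B1 `ratGaloisRepCofinalAt_of_curve` + B2
`isNewformOf_of_cofinalAt_of_carayolEuler hCE … (T₀ := N * ℓ)`. -/
theorem isNewformOf_of_congruenceAt_of_carayolEuler (ℓ : ℕ) [Fact ℓ.Prime] (hCA : CongruenceAt ℓ)
    (hCE : Carayol1986_eulerFactor) (W : WeierstrassCurve ℚ) [W.IsElliptic]
    {N : ℕ} [NeZero N] (f₀ : CuspForm (Gamma0 N) 2) (hf₀ : IsNewform0 f₀)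
    (hrat : ∀ n : ℕ, ∃ z : ℤ, cuspCoeff f₀ n = z)
    (hgood : ∀ v : HeightOneSpectrum (𝓞 ℚ), ¬ ((primesEquiv v : ℕ) ∣ N * ℓ) → W.HasGoodReductionAt v)
    (hap : ∀ p : ℕ, p.Prime → ¬ p ∣ N * ℓ → cuspCoeff f₀ p = (W.LFunction p : ℂ)) :
    IsNewformOf W f₀ := by
  sorry

/-- **H4 (closer for the VERBATIM stub).**  Leaves: `CongruenceAt ℓ` at the prime `ℓ` of the
instance, `Carayol1986_eulerFactor`, Carayol-level `hC`.  Recipe = gen-3 G3.B8: descend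
(`H1r_exists_rational_isNewform0_hasGoodReductionAt_cuspCoeff_eq`, gen-3, PROVED there: Néron–Ogg–
Shafarevich `neronOggShafarevich_holds` on the inertia clause of `IsModularGaloisRepTate`), H3,
`hC N hWf`, `⟨f₀, hWf⟩`. -/
theorem threeImpTwo_of_congruenceAt_of_carayolEuler
    (hCA : ∀ (ℓ : ℕ) [Fact ℓ.Prime], CongruenceAt ℓ) (hCE : Carayol1986_eulerFactor)
    (hC : ∀ (N : ℕ) [NeZero N], IsNewformOf.level_eq_conductorNorm (N := N)) :
    SigStubThreeImpTwo := by
  sorry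

/-- **H4′ (per prime, semistable: no `hC`)** — the shape the Frey instances I1/I3 consume
(`W := freyCurve a b`, `ℓ ∈ {3, 5}`; `Squarefree N_W`); level from
`IsNewformOf.level_eq_conductorNorm_of_squarefree` as in gen-3 G3.B6′. -/
theorem isModular_of_isModularGaloisRepTate_of_congruenceAt_of_squarefree (ℓ : ℕ) [Fact ℓ.Prime]
    (hCA : CongruenceAt ℓ) (hCE : Carayol1986_eulerFactor)
    (W : WeierstrassCurve ℚ) [W.IsElliptic] [NeZero (W.conductorNorm ℤ)]
    (hsq : Squarefree (W.conductorNorm ℤ)) (h : W.IsModularGaloisRepTate ℓ) : BCDT.IsModular W := by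
  sorry

/-! ### H5 · export: the hub fact `eichlerShimuraConstruction` NON-circularly -/

/-- **H5 (export; feeds the REGISTERED slot `stub_threeImpTwo_of_two_facts` unchanged).**
child + Igusa + Carayol-Euler ⇒ `eichlerShimuraConstruction`.  Recipe: for `f` rational take
`W := E_f` (`exists_periodPair_of_coeffField_eq_bot`, `exists_rat_g₂_g₃_of_lattice_eq_periodLattice`,
`isElliptic_shortModel`); `E_f` is good off `N` (Igusa) and `a_p(f) = a_p(E_f)` for `p ∤ N` (child), so
gen-3 B1 + B2 give `IsNewformOf E_f f`; the Manin clause with `c = 1` is the last six lines of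
`eichlerShimuraConstruction_of_exists_isNewformOf` (`IsNeronLatticeOf.lattice_eq`,
`isNeronLatticeOf_shortModel`).  Today the tree's only road to this fact is
`eichlerShimuraConstruction_of_exists_isNewformOf (h₁ : exists_isNewformOf)` — circular here. -/
theorem eichlerShimuraConstruction_of_congruenceRelation_of_igusa_of_carayolEuler
    (hCR : EichlerShimuraCongruenceRelation) (hIg : IgusaGoodReduction)
    (hCE : Carayol1986_eulerFactor) : eichlerShimuraConstruction := by
  sorry

/-! ### Assembly checks (kernel-checked modulo the sorried H3–H5) -/

/-- Road A (gen 4): the verbatim stub from {child, Igusa, Carayol-Euler, Carayol-level}, the child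
and Igusa entering only through the one-prime leaf. -/
example (hCR : EichlerShimuraCongruenceRelation) (hIg : IgusaGoodReduction)
    (hCE : Carayol1986_eulerFactor)
    (hC : ∀ (N : ℕ) [NeZero N], IsNewformOf.level_eq_conductorNorm (N := N)) : SigStubThreeImpTwo :=
  threeImpTwo_of_congruenceAt_of_carayolEuler
    (fun ℓ _ ↦ congruenceAt_of_congruenceRelation_of_igusa hCR hIg ℓ) hCE hC

/-- Road A fed by the skeleton's own currency `hES` instead (S2): {hES, Carayol-Euler, hC}. -/
example (hES : eichlerShimuraConstruction) (hCE : Carayol1986_eulerFactor)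
    (hC : ∀ (N : ℕ) [NeZero N], IsNewformOf.level_eq_conductorNorm (N := N)) : SigStubThreeImpTwo :=
  threeImpTwo_of_congruenceAt_of_carayolEuler
    (fun ℓ _ ↦ congruenceAt_of_eichlerShimuraConstruction hES ℓ) hCE hC

/-- Road R0 (REGISTERED slot `stub_threeImpTwo_of_two_facts`, Sketch.lean:584 — literally
`isModular_of_isModularGaloisRepTate_of_two_facts hES hC`, i.e. the three-facts theorem with Faltings
discharged; `CDTTheorem722TwoFactsProofs` is unbuilt on today's farm snapshot, so the three-facts form is
called here — zero skeleton change): its `hES` binder fed NON-circularly by H5. -/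
example (hCR : EichlerShimuraCongruenceRelation) (hIg : IgusaGoodReduction)
    (hCE : Carayol1986_eulerFactor)
    (hC : ∀ (N : ℕ) [NeZero N], IsNewformOf.level_eq_conductorNorm (N := N)) : SigStubThreeImpTwo :=
  fun W _ _ ℓ _ h ↦ isModular_of_isModularGaloisRepTate_of_three_facts
    (eichlerShimuraConstruction_of_congruenceRelation_of_igusa_of_carayolEuler hCR hIg hCE)
    isIsogenous_iff_frobeniusTrace_eq_holds hC W ℓ h

/-- The per-instance residual of the crux (I1, I2 at `ℓ = 3`; I3 at `ℓ = 5`): the realisation debt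
of `isModular_freyCurve_of_stubs` is `CongruenceAt 3 ∧ CongruenceAt 5`. -/
def CongruenceAtThreeAndFive : Prop :=
  @CongruenceAt 3 ⟨Nat.prime_three⟩ ∧ @CongruenceAt 5 ⟨by norm_num⟩

end Summit.ABC.ABC.Cruxes.FreyModularity.Sketch.StubIdeasThreeImpTwo1G4

end
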